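import Literature.MathematicalPhysics.QuantumFieldTheory.Balaban1983to89.B9Eq3105FamThreeLetters

/-!
# `Balaban1983to89.B9Eq3105FamThreeCover` — FAMILY 3 OF (3.105), `Σ_□ ζ_□̃·(DPD* − DP_□D*)·h_□O_□h_□`, SUMMED OVER THE COVER FROM A PER-CUBE MAJORANT OF THE
# LOCATED DIFFERENCE `ζ_□̃·(DPD* − P_□)·h_□` (sub-row G-B9-LETTERS, GAPS G-B9-05∕family 3, programme FAMTHREE FILE F3-C; lead g34 NEXT-ITEM RULING 2026-08-28
# 23:38Z; memo `lit-balaban-p33/g102/FAMTHREE-SCOPE.md` v2 + p33 g103 amendment A1∕A2, HOME/INBOX 2026-08-29T00:29Z)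

statement-level skeleton of published theorems with citation tags; proofs where landed; nothing here is a claim about the Yang–Mills mass gap

THE PRINTED LOCUS (verbatim, held `paper:balaban1985-cmp99-background-propagators`, journal page = PDF page + 388).  p. 414 (3.105), third sum:
«− Σ_□ ζ_□̃(DPD* − DP_□D*)h_□G_□h_□»; p. 415 l.8–24 (text layer p0027): «The expansion of the term in the third sum gives also small terms, except the following
one … This expression cancels the second term in the third sum.»; p. 412 l.22–36: «if we have a difference of propagators defined on two domains, then in an
estimate of this difference we have, besides the usual factors connected with propagators of a considered type, an exponential factor with a distance between
localizations and a closest point where a change was made»; (3.87) p. 409 («G₀ = Σ_□ h_□G_□h_□»); (3.91) p. 410; [4] (2.51)–(2.55) p. 232, (2.36) p. 229, p. 235,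
Lemma 2.1 (2.60)–(2.61) p. 234.

WHY THIS FILE.  The consumer `B9Thm310DeltaAIsUnitOfExpansion.eBlock_kernelFamilyBInv_GAY_of_localInverseCubes''` displays family 3 of (3.105) in `hrest` as
`Σ_□ conj b((M_{ζ_□}·(DPDsY i parS G′ (cfg U₁) − Pl □)·(M_{h_□}·O_□(cfg U₁)·M_{h_□}))^ℝ)` inside a sum bounded by `Θ′·e^{−δ₀d(a,a′)}` over the member's bond
carrier `(toB6 (geo9K i) Rr Hp, ιB∘blkV1)`.  Programme FAMTHREE splits its closing into (i) THIS FILE — the cover bookkeeping, which is letter-free: from a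
per-cube majorant `hX □` of the LOCATED difference `conj b((M_{ζ_□}·(P − Pl □)·M_{h_□})^ℝ) ≺ K_X·ℓ(a)⁻²·e^{−a_Xδ·d}` ((3.49)₄ shape, the smallness in `K_X`)
and the (3.42) blocks of the cut letters `O_□` it assembles the `hrest` summand exactly as Z2-cover did for family 2 (no separation here: the smallness is in
`K_X`; [4] (2.52)'s y″-sum by p21's `B9Eq395Small.conv_majorant`, the source indicator `𝟙[b′ ∈ S_□]` from the trailing `M_{h_□}`, the cover multiplicity
`Σ_□ 𝟙[b′ ∈ S_□] ≤ 3·5^{d+1}`), and (ii) the suppliers of `hX □` — F3-B (`B9Eq3105FamThreeCore`: the member-letter words `ΔSA + ASΔ − ΔSΔ` of the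
re-telescoped difference, modulo the displayed located `G′`-difference entries) and F3-B3 (the `C`-difference word `BΣB`).  So the state of family 3 is read
off ONE binder: `hX`.

WHAT THIS FILE CERTIFIES (kernel-checked; 0 `def`, 0 `def … : Prop`, 0 sorry; standard axioms only)

* §1 `conj_famThree_eq` — the family-3 word in real coordinates: `conj b((M_ζ·(P − Pl)·(M_h·O·M_h))^ℝ) = conj b((M_ζ·(P − Pl)·M_h)^ℝ)·conj b(O^ℝ)·mulOp(h♭)`.
* §2 ★★ `hasMajorant_famThree_core` — PER CUBE, for ANY site profiles `ζ`, ANY bond operators `P, Pl, O`: from `hX` (located difference, `K_X·ℓ(a)⁻²·e^{−a_Xδ₀d}`),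
  `hO` (`B_O·ℓ(y)²·e^{−b_Oδ₀d}`), the scale transfer of `ℓ²` at `α_st`, (2.61) at `b_O − ρ`, `α_st + ρ ≤ a_X`:
  `conj b((M_ζ·(P − Pl)·(M_{h_□}·O·M_{h_□}))^ℝ) ≺ 𝟙[b′ ∈ S_□]·(K_XB_OΛc₁(δ₀, b_O − ρ))·e^{−ρδ₀·d(a,b′)}`.
* §3 ★★★ `hasMajorant_sum_famThree` (the cover sum, `≺ 3·5^{d+1}·(K_XB_OΛc₁)·e^{−ρδ₀d}`), ★★★ `hasMajorant_sum_famThree_of_eBlock` (the consumer's letters: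
  `hO` READ OFF `hEO : ∀ □, EBlock (kernelFamilyBInv i B cfg (Oc □) par) B₀ δ U₁`, `B_O = M₂Σ‖b_j‖B₀`, `b_O = 1`), `hasMajorant_sum_famThree_zetaY_of_eBlock` (at the
  ζ of record `zetaY`, for the record — the ζ enters only through `hX`).

HONEST SCOPE ∕ NOT CLAIMED.  (i) `hX □` is DISPLAYED here (a hypothesis): its located smallness `K_X` is where p. 415's «small terms» live — F3-B supplies the three
member-letter words modulo the displayed `G′`-difference entries (memo §3 D1, p. 415 l.21–22 «terms with the differences G′_{□₀} − G′_□ … are small», [2] (1.11)–(1.12)),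
F3-B3 the `C`-difference word; nothing of that analysis is asserted in this file.  (ii) `hEO`, the member (2.61) and the scale transfer of `ℓ²` are DISPLAYED as in
Z2-cover (suppliers: the consumer's `hE`, p21∕p33 `B9GeoInputsMultiRateKLevelV1`, `scaleTransfer_len_geo9K`-type lemmas above thresholds).  (iii) NOT here: the
transposed `hV′` family-3 word (its located difference has GLOBAL sources — near columns as here plus a separation piece; file F3-D), the knit into `hrest`, the
smallness `hsmall`.  Count-neutral; NOT a node discharge; no summit ∕ sub-problem statement is proved; nothing continuum ∕ OS ∕ mass-gap ∕ Clay; YM mass gap NOT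
proved (Track A conditional rung).  No `sorry`, no `axiom`, no `… : Prop` fact, no `instance`, no `notation`, no `def`.  NEW file; nothing landed is modified.
Cell `lit-balaban`, seat `lit-balaban-p33` gen 103, 2026-08-29; `--supports stmt-QuantumFields-19200` as helper.  Net new unproved facts: 0.

RELATED IN THE TREE, NOT DUPLICATED (searched 2026-08-29: `rg 'famThree' Literature/` = F3-A only): p33 Z2-core∕Z2-cover `B9Eq3105FamTwoCore`∕`B9Eq3105FamTwoCover`
(the pattern; `geo9K_axioms`, `mem_SQT_of_hBdY_hTY_ne_zero` USED BY NAME), p21 `B9Eq395Small.conv_majorant`∕`hasMajorant_mul_mulOp_right`, `B9Thm39Sum.hasMajorant_localSum_right`,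
p21∕p38 `B9Thm37GpTorusRegularCubes.hcnt_SQT`, `B9CubeLettersInvReadDictBMajorants.hasMajorant_conj_G_of_eBlockInvB`, p33 `B9Eq3105ZetaY` — all USED BY NAME.
-/

noncomputable section

namespace Literature.MathematicalPhysics.QuantumFieldTheory.Balaban1983to89.B9Eq3105FamThreeCover

open NormedSpace Complex
open B6RandomWalk (HasMajorant hasMajorant_mono Ineq261 c1_nonneg Triangle254)
open B9FromB6 (EBlock)
open B9Thm34Ext (toB6)
open B9Thm37Sum (mulOp mulOp_apply)
open B9Ineq347 (ScaleTransfer)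
open B9Eq352DivFormLetters (conj)
open B9Thm39Sum (hasMajorant_localSum_right)
open B6KLevelCensusIndexV1 (KIdx)
open B6Cover236MultiLevelBlocks (cubes)
open B6GlobalChartV1 (blkV1)
open B6Ineq2142KLevelV1 (β)
open B9GeoNormsKLevelV1 (geo9K)
open B9Thm37CubeCoverCommutators (cutMulY cutMulY_apply hTY)
open B9Thm37GpTorusRegularCubes (SQT hcnt_SQT)
open B9Thm39CinvTorusRegular (conj_cutMulY)
open B9Eq395Small (conv_majorant hasMajorant_mul_mulOp_right)
open B9Eq3104CutoffCommutators (hBdY hBdY_apply DPDsY)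
open B9Eq3105ZetaY (zetaY)
open B9Eq3105FamTwoCore (geo9K_axioms mem_SQT_of_hBdY_hTY_ne_zero)
open B9CubeLettersInvReadings (kernelFamilyBInv)
open B9CubeLettersInvReadDictBMajorants (hasMajorant_conj_G_of_eBlockInvB)
open Node00 (SiteY BlkY IBondY FBondY CfgY SiteOpY BondOpY SiteParY BondParY toKT)

variable {d ℓ : ℕ} {hd : 1 ≤ d + 1} {hL : Odd (ℓ + 1) ∧ 1 < ℓ + 1} {b₀ b₁ : ℝ}
variable {𝔸 : Type} [NormedRing 𝔸] [NormedAlgebra ℂ 𝔸] [CompleteSpace 𝔸]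
variable {ι : Type} [Fintype ι]
variable (i : KIdx d ℓ hd hL b₀ b₁) (c : ↥(cubes i.D.toDomains)) (b : Module.Basis ι ℝ 𝔸)

/-! ## §1  The family-3 word in real coordinates -/

omit [CompleteSpace 𝔸] in
/-- ★ `conj b((M_ζ·(P − Pl)·(M_h·O·M_h))^ℝ) = conj b((M_ζ·(P − Pl)·M_h)^ℝ)·conj b(O^ℝ)·mulOp(h♭)` — the located difference, the cut letter, the trailing cut-off.
[cite: Balaban1985BackgroundPropagators, (3.105) p.414, (3.87) p.409; Balaban1984PropagatorsII, (2.52)–(2.55) p.232] -/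
theorem conj_famThree_eq (ζ h : SiteY i → ℝ) (P Pl O : (FBondY i → 𝔸) →ₗ[ℂ] (FBondY i → 𝔸)) :
    conj b ((cutMulY (𝔸 := 𝔸) (hBdY i ζ) * (P - Pl) * (cutMulY (𝔸 := 𝔸) (hBdY i h) * O * cutMulY (𝔸 := 𝔸) (hBdY i h))).restrictScalars ℝ) =
      conj b ((cutMulY (𝔸 := 𝔸) (hBdY i ζ) * (P - Pl) * cutMulY (𝔸 := 𝔸) (hBdY i h)).restrictScalars ℝ) * conj b (O.restrictScalars ℝ) *
        mulOp (fun p : FBondY i × ι => hBdY i h p.1) := by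
  have hsplit : ((cutMulY (𝔸 := 𝔸) (hBdY i ζ) * (P - Pl) * (cutMulY (𝔸 := 𝔸) (hBdY i h) * O * cutMulY (𝔸 := 𝔸) (hBdY i h))).restrictScalars ℝ :
      Module.End ℝ (FBondY i → 𝔸)) =
      (cutMulY (𝔸 := 𝔸) (hBdY i ζ) * (P - Pl) * cutMulY (𝔸 := 𝔸) (hBdY i h)).restrictScalars ℝ * O.restrictScalars ℝ *
        (cutMulY (𝔸 := 𝔸) (hBdY i h)).restrictScalars ℝ :=
    LinearMap.ext fun _ => rfl
  rw [hsplit, B9Eq352DivFormLetters.conj_mul, B9Eq352DivFormLetters.conj_mul, conj_cutMulY]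

/-! ## §2  The per-cube estimate from the located-difference majorant -/

omit [CompleteSpace 𝔸] in
open Classical in
set_option maxHeartbeats 1600000 in
/-- ★★ **FAMILY 3 OF (3.105) PER CUBE ON THE MEMBER's BOND CARRIER, FROM THE LOCATED DIFFERENCE.**  Let `ζ, h` be ANY site profiles with `|h♭| ≤ 1` and
`supp h♭` meeting only blocks of `S_□` (for `h = h_□`: `mem_SQT_of_hBdY_hTY_ne_zero`), `P, Pl, O` any bond operators with
`conj b((M_ζ·(P − Pl)·M_h)^ℝ) ≺ K_X·ℓ(a)⁻²·e^{−a_Xδ₀d}` (the located difference — p. 415's small terms live in `K_X`) and `conj b(O^ℝ) ≺ B_O·ℓ(y)²·e^{−b_Oδ₀d}`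
((3.42)₀ shape), (2.61) at `b_O − ρ`, the scale transfer of `ℓ²` at `α_st`, `α_st + ρ ≤ a_X`.  Then
`conj b((M_ζ·(P − Pl)·(M_h·O·M_h))^ℝ) ≺ 𝟙[b′ ∈ S_□]·(K_XB_OΛc₁(δ₀, b_O − ρ))·e^{−ρδ₀d(a,b′)}` — [4] (2.52)'s y″-sum (`conv_majorant`), weights `ℓ⁻²·ℓ² = 1`,
the trailing `M_h` localizes the source (`hasMajorant_mul_mulOp_right`).
[cite: Balaban1985BackgroundPropagators, (3.105) p.414, p.415 l.8–24, p.412 l.22–36, (3.49) p.399, (3.87) p.409; Balaban1984PropagatorsII, (2.52)–(2.55) p.232, p.235, Lemma 2.1 (2.60)–(2.61) p.234] -/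
theorem hasMajorant_famThree_core (ζ h : SiteY i → ℝ) [Fintype (geo9K i).Site] (ιB : BlkY i → IBondY i) (Rr : ℝ) (Hp : Prop)
    (hh1 : ∀ f : FBondY i, |hBdY i h f| ≤ 1) (hhS : ∀ f : FBondY i, hBdY i h f ≠ 0 → ιB (blkV1 i.hN i.D f) ∈ SQT i c)
    (P Pl O : (FBondY i → 𝔸) →ₗ[ℂ] (FBondY i → 𝔸)) (dB : ℕ) {δ₀ aX bO αst ρ KX BO Λ : ℝ}
    (hδ₀ : 0 ≤ δ₀) (hKX : 0 ≤ KX) (hBO : 0 ≤ BO) (hΛ : 0 ≤ Λ) (hρ : 0 ≤ ρ) (hsplit : αst + ρ ≤ aX)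
    (h261 : Ineq261 dB (toB6 (geo9K i) Rr Hp) δ₀ (bO - ρ)) (hST : ScaleTransfer (geo9K i) δ₀ αst Λ (fun a => (geo9K i).len a ^ 2))
    (hX : HasMajorant (g := toB6 (geo9K i) Rr Hp) (fun p : FBondY i × ι => ιB (blkV1 i.hN i.D p.1))
      (conj b ((cutMulY (𝔸 := 𝔸) (hBdY i ζ) * (P - Pl) * cutMulY (𝔸 := 𝔸) (hBdY i h)).restrictScalars ℝ))
      (fun a y => KX * ((geo9K i).len a ^ 2)⁻¹ * Real.exp (-(aX * δ₀ * (geo9K i).dist a y))))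
    (hO : HasMajorant (g := toB6 (geo9K i) Rr Hp) (fun p : FBondY i × ι => ιB (blkV1 i.hN i.D p.1)) (conj b (O.restrictScalars ℝ))
      (fun y b' => BO * (geo9K i).len y ^ 2 * Real.exp (-(bO * δ₀ * (geo9K i).dist y b')))) :
    HasMajorant (g := toB6 (geo9K i) Rr Hp) (fun p : FBondY i × ι => ιB (blkV1 i.hN i.D p.1))
      (conj b ((cutMulY (𝔸 := 𝔸) (hBdY i ζ) * (P - Pl) *
        (cutMulY (𝔸 := 𝔸) (hBdY i h) * O * cutMulY (𝔸 := 𝔸) (hBdY i h))).restrictScalars ℝ))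
      (fun a b' => (if b' ∈ SQT i c then (1 : ℝ) else 0) *
        ((KX * BO * Λ * B6.c1 dB δ₀ (bO - ρ)) * Real.exp (-(ρ * δ₀ * (geo9K i).dist a b')))) := by
  obtain ⟨htri, hsymm, hdnn⟩ := geo9K_axioms i Rr Hp
  have hℓ2 : ∀ a : (geo9K i).Site, 0 < (geo9K i).len a ^ 2 := fun a => pow_pos (B6KLevelCensusIndexV1.len_pos i a) 2
  set blk : FBondY i × ι → (geo9K i).Site := fun p => ιB (blkV1 i.hN i.D p.1) with hblk
  set m : FBondY i × ι → ℝ := fun p => hBdY i h p.1 with hm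
  have hm1 : ∀ p, |m p| ≤ 1 := fun p => hh1 _
  -- the cut letter with its trailing cut-off: source localized in `S_□`
  have hT := hasMajorant_mul_mulOp_right (R := Rr) (H := Hp) blk hO m hm1 (SQT i c) (fun p hp => hhS p.1 hp)
  -- [4] (2.52)'s y″-sum with the transfer of `ℓ²` and (2.61)
  have hX' : HasMajorant (g := toB6 (geo9K i) Rr Hp) blk
      (conj b ((cutMulY (𝔸 := 𝔸) (hBdY i ζ) * (P - Pl) * cutMulY (𝔸 := 𝔸) (hBdY i h)).restrictScalars ℝ))
      (fun a y => KX * ((geo9K i).len a ^ 2)⁻¹ * Real.exp (-(aX * δ₀ * (geo9K i).dist a y))) := hX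
  have hA := conv_majorant (R := Rr) (H := Hp) blk dB δ₀ aX αst ρ bO KX BO Λ (fun a => (geo9K i).len a ^ 2) (SQT i c)
    hKX hBO hΛ hℓ2 hδ₀ hρ hsplit htri hsymm hdnn hST h261 hX' hT
  rw [conj_famThree_eq, mul_assoc]
  exact hasMajorant_mono (g := toB6 (geo9K i) Rr Hp) _ hA fun a b' => le_of_eq (mul_assoc _ _ _)

/-! ## §3  The cover sum -/

omit [CompleteSpace 𝔸] in
open Classical in
set_option maxHeartbeats 1600000 in
/-- ★★★ **FAMILY 3 OF (3.105) SUMMED OVER THE COVER**: `Σ_□ conj b((M_{ζ_□}·(P − Pl_□)·(M_{h_□}·O_□·M_{h_□}))^ℝ) ≺ 3·5^{d+1}·(K_XB_OΛc₁(δ₀, b_O − ρ))·e^{−ρδ₀d}`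
from the per-cube located-difference majorants `hX □` (uniform constant `K_X`, rate `a_X`), the letters' blocks `hO □`, the transfer of `ℓ²`, (2.61)
(§2 per cube with the source indicator `𝟙[b′ ∈ S_□]`, `Σ_□ 𝟙[b′ ∈ S_□] ≤ 3·5^{d+1}`, `hasMajorant_localSum_right`).
[cite: Balaban1985BackgroundPropagators, (3.105) p.414, p.415 l.8–24, (3.91) p.410, (3.87) p.409; Balaban1984PropagatorsII, (2.52)–(2.55) p.232, (2.36) p.229, p.235, Lemma 2.1 (2.61) p.234] -/
theorem hasMajorant_sum_famThree (ζ : ↥(cubes i.D.toDomains) → SiteY i → ℝ)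
    [Fintype (geo9K i).Site] (ιB : BlkY i → IBondY i) (hι : ∀ s, β i.hN i.D i.hk (ιB s) = s) (Rr : ℝ) (Hp : Prop)
    (P : (FBondY i → 𝔸) →ₗ[ℂ] (FBondY i → 𝔸)) (Pl O : ↥(cubes i.D.toDomains) → (FBondY i → 𝔸) →ₗ[ℂ] (FBondY i → 𝔸)) (dB : ℕ)
    {δ₀ aX bO αst ρ KX BO Λ : ℝ}
    (hδ₀ : 0 ≤ δ₀) (hKX : 0 ≤ KX) (hBO : 0 ≤ BO) (hΛ : 0 ≤ Λ) (hρ : 0 ≤ ρ) (hsplit : αst + ρ ≤ aX)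
    (h261 : Ineq261 dB (toB6 (geo9K i) Rr Hp) δ₀ (bO - ρ)) (hST : ScaleTransfer (geo9K i) δ₀ αst Λ (fun a => (geo9K i).len a ^ 2))
    (hX : ∀ c : ↥(cubes i.D.toDomains), HasMajorant (g := toB6 (geo9K i) Rr Hp) (fun p : FBondY i × ι => ιB (blkV1 i.hN i.D p.1))
      (conj b ((cutMulY (𝔸 := 𝔸) (hBdY i (ζ c)) * (P - Pl c) * cutMulY (𝔸 := 𝔸) (hBdY i (hTY i c))).restrictScalars ℝ))
      (fun a y => KX * ((geo9K i).len a ^ 2)⁻¹ * Real.exp (-(aX * δ₀ * (geo9K i).dist a y))))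
    (hO : ∀ c : ↥(cubes i.D.toDomains), HasMajorant (g := toB6 (geo9K i) Rr Hp) (fun p : FBondY i × ι => ιB (blkV1 i.hN i.D p.1))
      (conj b ((O c).restrictScalars ℝ)) (fun y b' => BO * (geo9K i).len y ^ 2 * Real.exp (-(bO * δ₀ * (geo9K i).dist y b')))) :
    HasMajorant (g := toB6 (geo9K i) Rr Hp) (fun p : FBondY i × ι => ιB (blkV1 i.hN i.D p.1))
      (∑ c : ↥(cubes i.D.toDomains), conj b ((cutMulY (𝔸 := 𝔸) (hBdY i (ζ c)) * (P - Pl c) *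
        (cutMulY (𝔸 := 𝔸) (hBdY i (hTY i c)) * O c * cutMulY (𝔸 := 𝔸) (hBdY i (hTY i c)))).restrictScalars ℝ))
      (fun a b' => (3 * 5 ^ (d + 1)) *
        ((KX * BO * Λ * B6.c1 dB δ₀ (bO - ρ)) * Real.exp (-(ρ * δ₀ * (geo9K i).dist a b')))) := by
  have hκ : 0 ≤ KX * BO * Λ * B6.c1 dB δ₀ (bO - ρ) := mul_nonneg (mul_nonneg (mul_nonneg hKX hBO) hΛ) (c1_nonneg _ _ _)
  have hh1 : ∀ (c : ↥(cubes i.D.toDomains)) (f : FBondY i), |hBdY i (hTY i c) f| ≤ 1 := fun c f =>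
    B6Partition118KLevelTorus.abs_hT_le_one i.D (B9GeoLemma21KLevelV1.one_le_Mh i) (B9GeoLemma21KLevelV1.one_le_P i) c _
  exact hasMajorant_localSum_right (G := toB6 (geo9K i) Rr Hp) (fun p : FBondY i × ι => ιB (blkV1 i.hN i.D p.1))
    (fun c => conj b ((cutMulY (𝔸 := 𝔸) (hBdY i (ζ c)) * (P - Pl c) *
      (cutMulY (𝔸 := 𝔸) (hBdY i (hTY i c)) * O c * cutMulY (𝔸 := 𝔸) (hBdY i (hTY i c)))).restrictScalars ℝ))
    (fun c b' => if b' ∈ SQT i c then (1 : ℝ) else 0)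
    (fun a b' => (KX * BO * Λ * B6.c1 dB δ₀ (bO - ρ)) * Real.exp (-(ρ * δ₀ * (geo9K i).dist a b')))
    (3 * 5 ^ (d + 1)) (fun a b' => mul_nonneg hκ (Real.exp_nonneg _))
    (fun c => hasMajorant_famThree_core i c b (ζ c) (hTY i c) ιB Rr Hp (hh1 c) (fun f hf => mem_SQT_of_hBdY_hTY_ne_zero i c ιB hι hf)
      P (Pl c) (O c) dB hδ₀ hKX hBO hΛ hρ hsplit h261 hST (hX c) (hO c))
    (hcnt_SQT i)

/-! ## §4  The letters' blocks read off their `EBlock`s (the consumer's `hE`); the ζ of record -/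

variable {B : B9.Backgrounds} (cfg : B.Cfg → CfgY 𝔸 i) {U₁ : B.Cfg}

open Classical in
set_option maxHeartbeats 1600000 in
/-- ★★★ **THE CONSUMER's FAMILY-3 SUMMAND OF `hrest`, MODULO THE PER-CUBE LOCATED-DIFFERENCE MAJORANT**: with `hEO : ∀ □, EBlock (kernelFamilyBInv i B cfg (Oc □) par) B₀ δ U₁`
(the (3.42) blocks of the cut letters), ANY family of site profiles `ζ_□`, the member word `P` and cube words `Pl □` with `hX □ : conj b((M_{ζ_□}·(P − Pl □)·M_{h_□})^ℝ) ≺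
K_X·ℓ(a)⁻²·e^{−a_Xδ·d}`, (2.61) at `(δ, 1 − ρ)`, the scale transfer of `ℓ²` at `(δ, α_st)`, `α_st + ρ ≤ a_X`:
`Σ_□ conj b((M_{ζ_□}·(P − Pl □)·(M_{h_□}·Oc □ (cfg U₁)·M_{h_□}))^ℝ) ≺ 3·5^{d+1}·(K_X(M₂Σ‖b_j‖B₀)Λc₁(δ, 1 − ρ))·e^{−ρδ·d(a,b′)}`.
[cite: Balaban1985BackgroundPropagators, (3.105) p.414, p.415 l.8–24, p.412 l.22–36, Cor. 3.6 p.408, (3.87) p.409, (3.91) p.410; Balaban1984PropagatorsII, (2.51)–(2.55) p.232, Lemma 2.1 (2.61) p.234] -/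
theorem hasMajorant_sum_famThree_of_eBlock (par : BondParY 𝔸 i) (Oc : ↥(cubes i.D.toDomains) → BondOpY 𝔸 i) {B₀ δ : ℝ} (hB₀ : 0 ≤ B₀) (hδ : 0 ≤ δ)
    (hEO : ∀ c : ↥(cubes i.D.toDomains), EBlock (kernelFamilyBInv i B cfg (Oc c) par) B₀ δ U₁)
    {M₂ : ℝ} (hM₂ : 0 ≤ M₂) (hrepr : ∀ (v : 𝔸) (j : ι), |b.repr v j| ≤ M₂ * ‖v‖)
    (ζ : ↥(cubes i.D.toDomains) → SiteY i → ℝ)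
    [Fintype (geo9K i).Site] (ιB : BlkY i → IBondY i) (hι : ∀ s, β i.hN i.D i.hk (ιB s) = s) (Rr : ℝ) (Hp : Prop)
    (P : (FBondY i → 𝔸) →ₗ[ℂ] (FBondY i → 𝔸)) (Pl : ↥(cubes i.D.toDomains) → (FBondY i → 𝔸) →ₗ[ℂ] (FBondY i → 𝔸)) (dB : ℕ) {aX αst ρ KX Λ : ℝ}
    (hKX : 0 ≤ KX) (hΛ : 0 ≤ Λ) (hρ : 0 ≤ ρ) (hsplit : αst + ρ ≤ aX)
    (h261 : Ineq261 dB (toB6 (geo9K i) Rr Hp) δ (1 - ρ)) (hST : ScaleTransfer (geo9K i) δ αst Λ (fun a => (geo9K i).len a ^ 2))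
    (hX : ∀ c : ↥(cubes i.D.toDomains), HasMajorant (g := toB6 (geo9K i) Rr Hp) (fun p : FBondY i × ι => ιB (blkV1 i.hN i.D p.1))
      (conj b ((cutMulY (𝔸 := 𝔸) (hBdY i (ζ c)) * (P - Pl c) * cutMulY (𝔸 := 𝔸) (hBdY i (hTY i c))).restrictScalars ℝ))
      (fun a y => KX * ((geo9K i).len a ^ 2)⁻¹ * Real.exp (-(aX * δ * (geo9K i).dist a y)))) :
    HasMajorant (g := toB6 (geo9K i) Rr Hp) (fun p : FBondY i × ι => ιB (blkV1 i.hN i.D p.1))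
      (∑ c : ↥(cubes i.D.toDomains), conj b ((cutMulY (𝔸 := 𝔸) (hBdY i (ζ c)) * (P - Pl c) *
        (cutMulY (𝔸 := 𝔸) (hBdY i (hTY i c)) * Oc c (cfg U₁) * cutMulY (𝔸 := 𝔸) (hBdY i (hTY i c)))).restrictScalars ℝ))
      (fun a b' => (3 * 5 ^ (d + 1)) *
        ((KX * (M₂ * (∑ j, ‖b j‖) * B₀) * Λ * B6.c1 dB δ (1 - ρ)) * Real.exp (-(ρ * δ * (geo9K i).dist a b')))) := by
  have hSb : 0 ≤ ∑ j, ‖b j‖ := Finset.sum_nonneg fun _ _ => norm_nonneg _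
  have hBO : 0 ≤ M₂ * (∑ j, ‖b j‖) * B₀ := mul_nonneg (mul_nonneg hM₂ hSb) hB₀
  have hO : ∀ c : ↥(cubes i.D.toDomains), HasMajorant (g := toB6 (geo9K i) Rr Hp) (fun p : FBondY i × ι => ιB (blkV1 i.hN i.D p.1))
      (conj b ((Oc c (cfg U₁)).restrictScalars ℝ))
      (fun y b' => (M₂ * (∑ j, ‖b j‖) * B₀) * (geo9K i).len y ^ 2 * Real.exp (-(1 * δ * (geo9K i).dist y b'))) := fun c =>
    hasMajorant_mono (g := toB6 (geo9K i) Rr Hp) _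
      (hasMajorant_conj_G_of_eBlockInvB i b cfg (Oc c) par (Rr := Rr) (Hp := Hp) (hEO c) hB₀ ιB hι hM₂ hrepr ((Oc c (cfg U₁)).restrictScalars ℝ) (fun _ => rfl))
      fun a a' => by rw [one_mul]
  exact hasMajorant_sum_famThree i b ζ ιB hι Rr Hp P Pl (fun c => Oc c (cfg U₁)) dB (bO := 1) hδ hKX hBO hΛ hρ hsplit h261 hST hX hO

open Classical in
set_option maxHeartbeats 1600000 in
/-- ★★ **AT THE ζ OF RECORD AND THE CONSUMER's `P`**: `hasMajorant_sum_famThree_of_eBlock` with `ζ_□ := zetaY i □`, `P := DPDsY i parS G′ (cfg U₁)` — the `hrest` family-3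
summand of `eBlock_kernelFamilyBInv_GAY_of_localInverseCubes''` verbatim, modulo `hX` (suppliers F3-B ∕ F3-B3), `hEO`, the member (2.61), the transfer of `ℓ²`.
[cite: Balaban1985BackgroundPropagators, (3.105) p.414 («ζ_□̃ … = 1 on a cube containing □»), p.415 l.8–24, Cor. 3.6 p.408, (3.87) p.409, (3.91) p.410; Balaban1984PropagatorsII, (2.51)–(2.55) p.232, Lemma 2.1 (2.61) p.234] -/
theorem hasMajorant_sum_famThree_zetaY_of_eBlock (par : BondParY 𝔸 i) (parS : SiteParY 𝔸 i) (Gp : SiteOpY 𝔸 i)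
    (Oc : ↥(cubes i.D.toDomains) → BondOpY 𝔸 i) {B₀ δ : ℝ} (hB₀ : 0 ≤ B₀) (hδ : 0 ≤ δ)
    (hEO : ∀ c : ↥(cubes i.D.toDomains), EBlock (kernelFamilyBInv i B cfg (Oc c) par) B₀ δ U₁)
    {M₂ : ℝ} (hM₂ : 0 ≤ M₂) (hrepr : ∀ (v : 𝔸) (j : ι), |b.repr v j| ≤ M₂ * ‖v‖)
    [Fintype (geo9K i).Site] (ιB : BlkY i → IBondY i) (hι : ∀ s, β i.hN i.D i.hk (ιB s) = s) (Rr : ℝ) (Hp : Prop)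
    (Pl : ↥(cubes i.D.toDomains) → (FBondY i → 𝔸) →ₗ[ℂ] (FBondY i → 𝔸)) (dB : ℕ) {aX αst ρ KX Λ : ℝ}
    (hKX : 0 ≤ KX) (hΛ : 0 ≤ Λ) (hρ : 0 ≤ ρ) (hsplit : αst + ρ ≤ aX)
    (h261 : Ineq261 dB (toB6 (geo9K i) Rr Hp) δ (1 - ρ)) (hST : ScaleTransfer (geo9K i) δ αst Λ (fun a => (geo9K i).len a ^ 2))
    (hX : ∀ c : ↥(cubes i.D.toDomains), HasMajorant (g := toB6 (geo9K i) Rr Hp) (fun p : FBondY i × ι => ιB (blkV1 i.hN i.D p.1))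
      (conj b ((cutMulY (𝔸 := 𝔸) (hBdY i (zetaY i c)) * (DPDsY i parS Gp (cfg U₁) - Pl c) * cutMulY (𝔸 := 𝔸) (hBdY i (hTY i c))).restrictScalars ℝ))
      (fun a y => KX * ((geo9K i).len a ^ 2)⁻¹ * Real.exp (-(aX * δ * (geo9K i).dist a y)))) :
    HasMajorant (g := toB6 (geo9K i) Rr Hp) (fun p : FBondY i × ι => ιB (blkV1 i.hN i.D p.1))
      (∑ c : ↥(cubes i.D.toDomains), conj b ((cutMulY (𝔸 := 𝔸) (hBdY i (zetaY i c)) * (DPDsY i parS Gp (cfg U₁) - Pl c) *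
        (cutMulY (𝔸 := 𝔸) (hBdY i (hTY i c)) * Oc c (cfg U₁) * cutMulY (𝔸 := 𝔸) (hBdY i (hTY i c)))).restrictScalars ℝ))
      (fun a b' => (3 * 5 ^ (d + 1)) *
        ((KX * (M₂ * (∑ j, ‖b j‖) * B₀) * Λ * B6.c1 dB δ (1 - ρ)) * Real.exp (-(ρ * δ * (geo9K i).dist a b')))) :=
  hasMajorant_sum_famThree_of_eBlock i b cfg par Oc hB₀ hδ hEO hM₂ hrepr (fun c => zetaY i c) ιB hι Rr Hp (DPDsY i parS Gp (cfg U₁)) Pl dB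
    hKX hΛ hρ hsplit h261 hST hX

end Literature.MathematicalPhysics.QuantumFieldTheory.Balaban1983to89.B9Eq3105FamThreeCover

end
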